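import Literature.MathematicalPhysics.QuantumFieldTheory.Balaban1983to89.Beta.RemainderKernelGreenCoercive
import Literature.MathematicalPhysics.QuantumFieldTheory.Balaban1983to89.Beta.RemainderKernelBlockAveraging

/-!
# The `ℤ^d` Green's function of Bałaban's one-step block-averaging operator `−Δ + aQ*Q` (`a > 0`, blocks of side
# `L ≥ 2`) EXISTS, is two-sided, decays exponentially and is jointly `L`-periodic — no smallness, no mass
# (`Beta.RemainderKernelGreenBlockAveraging`)

statement-level skeleton of published theorems with citation tags; proofs where landed; nothing here is a claim
about the Yang–Mills mass gap.

HONEST FRAMING (cell rule).  Bookkeeping for the k-uniform remainder chain of row (D4) (`RemainderConst` ⇐ ONE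
`ChainTFac190` instance, `Beta.RemainderDecay190`); discharges NOTHING of `BetaPertH`; NOT B12 Thm 2, NOT the continuum
limit, NOT Clay.  Unit `b2b-balaban-beta-an4` gen 99 (BINDER row D4 OWNER; cell pub-balaban).  Imports
`Beta.RemainderKernelGreenCoercive` (gen 98∕99: **`exists_green_of_coercive_hasRange`**) and
`Beta.RemainderKernelBlockAveraging` (gen 99: `hasRange_blockAvg`, `abs_blockAvg_le`, `isPeriodic₂_blockAvg`,
**`coercive_blockAvg`**, `coerciveConst_pos`) ONLY, BY NAME.  [folklore] — a two-line composition, filed apart from its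
parents only because of the farm's olean lane.

WHAT.  For `T = −Δ + aQ*Q` on `ℤ^d` by its entries (`hT`; blocks `L·b + {0,…,n}^d`, `L = n + 1`), `a > 0` and `n ≥ 1`:
**`exists_green_blockAvg`** — `∃ κ > 0, ∃ G, T ∘ G = δ = G ∘ T ∧ |G(x,y)| ≤ (2∕min(2∕(n(n+1)), a))·e^{−κ|x−y|₁} ∧
G jointly L-periodic` (and `m`-periodic for every period `m` of `T`); `exists_green_blockAvg_periodic`: jointly
`s`-periodic for every multiple `s` of `L` — a smallness-free, mass-free INHABITANT of the model road's kernel letters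
(`Decay₂ ∧ IsPeriodic₂`, `EntrywiseVolumeLimit` §4's labelled input `K^∞`) that is an operator OF BAŁABAN'S — the
unit-lattice, scalar, one-step form of `G₀ = (Δ + aQ*Q)⁻¹` ([5] (1.132)–(1.134) p. 39).  **`torusGreen_blockAvg`**:
for `L ∣ s` the torus matrix `periodise₂ s T` of `−Δ + aQ*Q` on `(ℤ∕sℤ)^d` is invertible and its inverse IS the
periodisation (image sum) of `G`, two-sided (gen 9's `EntrywiseVolumeLimit.lemma222_periodic`);
**`tendsto_torusGreen_blockAvg`**: along any sequence of cubic tori with sides `L ∣ side t → ∞`, every family of right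
inverses of the torus matrices converges ENTRYWISE to `G` — gen 9's `EntrywiseVolumeLimit` §4 LABELLED INPUT («a `ℤ^d`
kernel `S` with `T ∘ S = δ`, decaying, jointly periodic» — there an assumption, «e.g. `−Δ + a Q*Q (+ m²)`») DISCHARGED
for this operator; `volumeRate_torusGreen_blockAvg`: the same with gen 9's explicit VOLUME RATE per base point
(`ScalarVolumeRate`, tail factor `imageTail d (κ·side t∕4) → 0`).
WHAT IS *NOT* DONE: the rate `κ` and the constant depend on the block side — NOTHING uniform in the step `k` ([5]
Prop. 1.2 (1.110) p. 35: `δ₀` depending on `d` only — NOT reached); scalar fields, no `dPd*`, no covariant Laplacian,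
no averaging-constrained subspace; nothing of [5] asserted or valued.  Row D4 class UNCHANGED (instance 0∕1;
critical-path width 0 = NODE O; D4 DISCHARGE NO DATE).  No `def`, no named fact, no `sorry`, standard axioms.
HONEST DEPENDENCY: continuum YM on T⁴ ⇐ BetaPertH ∧ nine spine estimates (0/9 proved); BetaPertH ⇐ (D1) ∧ (D4) ∧
CAP+tail; G-an2-4 gates asym, D1 and NE2/3/4.

Sources: [5] = T. Bałaban, Commun. Math. Phys. **95** (1984) 17–40 [Balaban1984PropagatorsI]: (1.18) p. 20, (1.69) p. 29,
(1.132)–(1.134) p. 39, Prop. 1.2 (1.110) p. 35; J.-M. Combes, L. Thomas, Commun. Math. Phys. **34** (1973) 251–270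
[CombesThomas1973], §II (via `RemainderKernelGreenCoercive`).
-/

namespace Literature.MathematicalPhysics.QuantumFieldTheory.Balaban1983to89.Beta.RemainderKernelGreenBlockAveraging

open Literature.MathematicalPhysics.QuantumFieldTheory.Balaban1983to89
open Literature.MathematicalPhysics.QuantumFieldTheory.Balaban1983to89.B12Sec2to5 (l1)
open Literature.MathematicalPhysics.QuantumFieldTheory.Balaban1983to89.Beta
  (Kernel₂ Decay₂ IsPeriodic₂ HasRange RowBound compKer kdelta Site siteOf periodise₂ lemma222_periodic
    abs_periodise₂_le tendsto_torusGreen scalarVolumeRate_torusGreen ScalarVolumeRate baseFamily baseFun imageTail)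
open Literature.MathematicalPhysics.QuantumFieldTheory.Balaban1983to89.Beta.RemainderKernelGreenCoercive
  (exists_green_of_coercive_hasRange rowBound_of_hasRange)
open _root_.Filter
open scoped _root_.Topology
open Literature.MathematicalPhysics.QuantumFieldTheory.Balaban1983to89.Beta.RemainderKernelBlockAveraging
  (hasRange_blockAvg abs_blockAvg_le isPeriodic₂_blockAvg coercive_blockAvg coerciveConst_pos)

variable {d : ℕ} {T : Kernel₂ d} {n : ℕ} {a : ℝ}

/-- **THE GREEN'S FUNCTION OF `−Δ + aQ*Q` ON `ℤ^d`** (`a > 0`, blocks of side `L = n + 1 ≥ 2`): a two-sided inverse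
kernel `G` with `|G(x,y)| ≤ (2∕min(2∕(n(n+1)), a))·e^{−κ|x−y|₁}` for some `κ > 0`, jointly `L`-periodic, and jointly
`m`-periodic for every period `m` of `T`.  Smallness-free Combes–Thomas (`exists_green_of_coercive_hasRange`) fed with
the blockwise-Poincaré coercivity `coercive_blockAvg`. [cite: Balaban1984PropagatorsI, (1.132) p.39] [folklore] -/
theorem exists_green_blockAvg
    (hT : ∀ x y, T x y = (if x = y then (2 * d : ℝ) else if l1 (x - y) = 1 then -1 else 0)
      + (if (∀ i, x i / ((n + 1 : ℕ) : ℤ) = y i / ((n + 1 : ℕ) : ℤ)) then a / ((n + 1 : ℕ) : ℝ) ^ d else 0))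
    (ha : 0 < a) (hn : 1 ≤ n) :
    ∃ κ : ℝ, 0 < κ ∧ ∃ G : Kernel₂ d, compKer T G = kdelta ∧ compKer G T = kdelta ∧
      Decay₂ G (2 / min (2 / ((n : ℝ) * (n + 1))) a) κ ∧ IsPeriodic₂ (n + 1) G ∧
      ∀ m : ℕ, IsPeriodic₂ m T → IsPeriodic₂ m G := by
  obtain ⟨κ, hκ, G, h1, h2, h3, h4⟩ := exists_green_of_coercive_hasRange (hasRange_blockAvg hT)
    (coerciveConst_pos ha hn) (abs_blockAvg_le hT ha.le) (coercive_blockAvg hT ha.le hn)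
  exact ⟨κ, hκ, G, h1, h2, h3, h4 _ (isPeriodic₂_blockAvg hT), h4⟩

/-- The Green's function is jointly `s`-periodic for every multiple `s` of the block side `L` — the block-periodic
operators of one renormalization step on the torus of side `s` periodise it (`EntrywiseVolumeLimit.lemma222_periodic`).
[cite: Balaban1984PropagatorsI, (1.132) p.39] [folklore] -/
theorem exists_green_blockAvg_periodic
    (hT : ∀ x y, T x y = (if x = y then (2 * d : ℝ) else if l1 (x - y) = 1 then -1 else 0)
      + (if (∀ i, x i / ((n + 1 : ℕ) : ℤ) = y i / ((n + 1 : ℕ) : ℤ)) then a / ((n + 1 : ℕ) : ℝ) ^ d else 0))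
    (ha : 0 < a) (hn : 1 ≤ n) {s : ℕ} (hs : n + 1 ∣ s) :
    ∃ κ : ℝ, 0 < κ ∧ ∃ G : Kernel₂ d, compKer T G = kdelta ∧ compKer G T = kdelta ∧
      Decay₂ G (2 / min (2 / ((n : ℝ) * (n + 1))) a) κ ∧ IsPeriodic₂ s T ∧ IsPeriodic₂ s G := by
  obtain ⟨κ, hκ, G, h1, h2, h3, h4, h5⟩ := exists_green_blockAvg hT ha hn
  exact ⟨κ, hκ, G, h1, h2, h3, (isPeriodic₂_blockAvg hT).of_dvd hs, h5 _ ((isPeriodic₂_blockAvg hT).of_dvd hs)⟩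


/-- Rows of `−Δ + aQ*Q` are absolutely summable (finite range + bounded entries).
[cite: Balaban1984PropagatorsI, (1.132) p.39] [folklore] -/
theorem summable_abs_row_blockAvg
    (hT : ∀ x y, T x y = (if x = y then (2 * d : ℝ) else if l1 (x - y) = 1 then -1 else 0)
      + (if (∀ i, x i / ((n + 1 : ℕ) : ℤ) = y i / ((n + 1 : ℕ) : ℤ)) then a / ((n + 1 : ℕ) : ℝ) ^ d else 0))
    (ha : 0 ≤ a) (x : Fin d → ℤ) : Summable fun y => |T x y| :=
  (rowBound_of_hasRange (hasRange_blockAvg hT) (abs_blockAvg_le hT ha)).summable_abs x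

/-- **THE ONE-STEP COVARIANCE ON EVERY TORUS WHOSE SIDE THE BLOCKS DIVIDE.**  For `L ∣ s` the torus matrix
`T̂ = periodise₂ s T` of `−Δ + aQ*Q` on `(ℤ∕sℤ)^d` is invertible, and its inverse IS the periodisation (image sum) of the
`ℤ^d` Green's function `G` — two-sided (gen 9's `lemma222_periodic`); `G` decays exponentially and is jointly `s`-periodic,
and the torus Green's function is bounded ENTRYWISE by `(2∕min(2∕(n(n+1)),a))·Σ_w e^{−κ|w|₁}` UNIFORMLY IN THE VOLUME `s`
(gen 9's `abs_periodise₂_le`). [cite: Balaban1984PropagatorsI, (1.132) p.39] [folklore] -/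
theorem torusGreen_blockAvg
    (hT : ∀ x y, T x y = (if x = y then (2 * d : ℝ) else if l1 (x - y) = 1 then -1 else 0)
      + (if (∀ i, x i / ((n + 1 : ℕ) : ℤ) = y i / ((n + 1 : ℕ) : ℤ)) then a / ((n + 1 : ℕ) : ℝ) ^ d else 0))
    (ha : 0 < a) (hn : 1 ≤ n) {s : ℕ} [NeZero s] (hs : n + 1 ∣ s) :
    ∃ κ : ℝ, 0 < κ ∧ ∃ G : Kernel₂ d, compKer T G = kdelta ∧ compKer G T = kdelta ∧
      Decay₂ G (2 / min (2 / ((n : ℝ) * (n + 1))) a) κ ∧ IsPeriodic₂ s G ∧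
      Matrix.of (periodise₂ s T) * Matrix.of (periodise₂ s G) = 1 ∧
      Matrix.of (periodise₂ s G) * Matrix.of (periodise₂ s T) = 1 ∧
      ∀ x y : Site d s, |periodise₂ s G x y|
        ≤ 2 / min (2 / ((n : ℝ) * (n + 1))) a * ∑' w : Fin d → ℤ, Real.exp (-κ * l1 w) := by
  obtain ⟨κ, hκ, G, h1, h2, h3, -, h5⟩ := exists_green_blockAvg hT ha hn
  have hsG : IsPeriodic₂ s G := h5 _ ((isPeriodic₂_blockAvg hT).of_dvd hs)
  obtain ⟨m1, m2⟩ := lemma222_periodic (summable_abs_row_blockAvg hT ha.le) hsG (h3.rowBound hκ) h1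
  exact ⟨κ, hκ, G, h1, h2, h3, hsG, m1, m2, fun x y => abs_periodise₂_le (h3.rowBound hκ) x y⟩

/-- **GEN 9'S LABELLED INPUT DISCHARGED FOR `−Δ + aQ*Q`** (`EntrywiseVolumeLimit` §4 took «a `ℤ^d` kernel `S` with
`T ∘ S = δ`, decaying, jointly periodic for every torus of the sequence» as an INPUT): along ANY sequence of cubic tori
whose sides are multiples of the block side and tend to infinity, every family of right inverses of the torus matrices
of `−Δ + aQ*Q` converges ENTRYWISE to the `ℤ^d` Green's function.
[cite: Balaban1984PropagatorsI, (1.132) p.39] [folklore] -/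
theorem tendsto_torusGreen_blockAvg
    (hT : ∀ x y, T x y = (if x = y then (2 * d : ℝ) else if l1 (x - y) = 1 then -1 else 0)
      + (if (∀ i, x i / ((n + 1 : ℕ) : ℤ) = y i / ((n + 1 : ℕ) : ℤ)) then a / ((n + 1 : ℕ) : ℝ) ^ d else 0))
    (ha : 0 < a) (hn : 1 ≤ n) {side : ℕ → ℕ} [∀ t, NeZero (side t)] (hside : Tendsto side atTop atTop)
    (hdvd : ∀ t, n + 1 ∣ side t) :
    ∃ G : Kernel₂ d, compKer T G = kdelta ∧ compKer G T = kdelta ∧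
      (∃ κ : ℝ, 0 < κ ∧ Decay₂ G (2 / min (2 / ((n : ℝ) * (n + 1))) a) κ) ∧
      ∀ Gt : (t : ℕ) → Matrix (Site d (side t)) (Site d (side t)) ℝ,
        (∀ t, Matrix.of (periodise₂ (side t) T) * Gt t = 1) →
        ∀ x y : Fin d → ℤ,
          Tendsto (fun t => Gt t (siteOf d (side t) x) (siteOf d (side t) y)) atTop (𝓝 (G x y)) := by
  obtain ⟨κ, hκ, G, h1, h2, h3, -, h5⟩ := exists_green_blockAvg hT ha hn
  have hS : ∀ t, IsPeriodic₂ (side t) G := fun t => h5 _ ((isPeriodic₂_blockAvg hT).of_dvd (hdvd t))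
  exact ⟨G, h1, h2, ⟨κ, hκ, h3⟩, fun Gt hGt x y =>
    tendsto_torusGreen (summable_abs_row_blockAvg hT ha.le) hS h3 hκ h1 hside hGt x y⟩


/-- **… WITH THE VOLUME RATE, per base point** (gen 9's `scalarVolumeRate_torusGreen`): for `L ∣ side t`, any right
inverses `Ĝ_t` of the torus matrices of `−Δ + aQ*Q` satisfy `|Ĝ_t([b]+x, [b]) − G(b + x̂, b)| ≤ C·imageTail d (κ·side t∕4)·
e^{−(κ∕2)|x̂|₁}` with `C = 2∕min(2∕(n(n+1)), a)` — constants free of the base point and of the volume history; the tail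
factor tends to `0` as `side t → ∞` (`VolumeImages.tendsto_imageTail_side`). [cite: Balaban1984PropagatorsI, (1.132) p.39]
[folklore] -/
theorem volumeRate_torusGreen_blockAvg
    (hT : ∀ x y, T x y = (if x = y then (2 * d : ℝ) else if l1 (x - y) = 1 then -1 else 0)
      + (if (∀ i, x i / ((n + 1 : ℕ) : ℤ) = y i / ((n + 1 : ℕ) : ℤ)) then a / ((n + 1 : ℕ) : ℝ) ^ d else 0))
    (ha : 0 < a) (hn : 1 ≤ n) {side : ℕ → ℕ} [∀ t, NeZero (side t)] (hdvd : ∀ t, n + 1 ∣ side t) :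
    ∃ κ : ℝ, 0 < κ ∧ ∃ G : Kernel₂ d, compKer T G = kdelta ∧ compKer G T = kdelta ∧
      Decay₂ G (2 / min (2 / ((n : ℝ) * (n + 1))) a) κ ∧
      ∀ Gt : (t : ℕ) → Matrix (Site d (side t)) (Site d (side t)) ℝ,
        (∀ t, Matrix.of (periodise₂ (side t) T) * Gt t = 1) →
        ∀ b : Fin d → ℤ, ScalarVolumeRate side (baseFamily side (fun t x y => Gt t x y) b) (baseFun G b)
          (fun t => 2 / min (2 / ((n : ℝ) * (n + 1))) a * imageTail d (κ * side t / 4)) (κ / 2) := by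
  obtain ⟨κ, hκ, G, h1, h2, h3, -, h5⟩ := exists_green_blockAvg hT ha hn
  have hS : ∀ t, IsPeriodic₂ (side t) G := fun t => h5 _ ((isPeriodic₂_blockAvg hT).of_dvd (hdvd t))
  exact ⟨κ, hκ, G, h1, h2, h3, fun Gt hGt b =>
    scalarVolumeRate_torusGreen (summable_abs_row_blockAvg hT ha.le) hS h3 hκ h1 hGt b⟩

end Literature.MathematicalPhysics.QuantumFieldTheory.Balaban1983to89.Beta.RemainderKernelGreenBlockAveraging
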